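import Literature.NumberTheory.Automorphic.Liu2021.NablaGaloisDescent
import Mathlib.AlgebraicGeometry.Noetherian
import HarnessLib

/-!
# Liu 2021 Def. 2.1 (1): `∇X` EXISTS for every scheme of finite type over any field

[Liu2021] = Yifeng Liu, *Fourier–Jacobi cycles and arithmetic relative trace formula*, Camb. J. Math. **9** (2021)
= arXiv:2102.11518, §2.1 Def. 2.1 (1) (`FJcycle.tex` l. 1171–1174): «We denote by `∇X` the smallest open and closed subscheme
of `X × X` containing the diagonal `ΔX`» — typed in the tree as the carrier structure `AppendixC.Nabla X` (`AppendixC/Glue.lean`: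
an open and closed immersion into `X × X` through which `ΔX` factors, minimal among such).  PROOF FILE (theorems only; no
definition, no named fact, no instance, no `sorry`).  Cell hodgecm-mathlib (D-0151), count-neutral capital.

So far the tree produced a `∇X` only from an Albanese datum (`Albanese.nabla`), for SPLIT schemes
(`Nabla.nonempty_of_isColimit`, `Liu2021/NablaTransitive`) or by Galois descent from a splitting field
(`Nabla.exists_of_nabla_baseChange`, smooth projective `X` in characteristic zero).  The existence implicit in Liu's «the
smallest» is elementary and general:

* `isClopen_sInter_setOf_isClopen` — in a NOETHERIAN topological space every clopen set is a union of irreducible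
  components (an irreducible component is connected, so it lies inside or outside a clopen set), hence there are only
  finitely many clopen sets and ANY family of clopen sets has clopen intersection.
* `Nabla.nonempty_of_noetherianSpace` — **for a `k`-scheme `X` with `X × X` Noetherian as a topological space, `∇X` exists**:
  the intersection `W₀` of all clopen subsets of `X × X` containing `ΔX` is clopen, contains `ΔX` and is contained in (the
  image of) every open and closed subscheme through which `ΔX` factors; the tree's constructor `Nabla.exists_of_isClopen`
  turns `W₀` into a `∇X`.
* `Nabla.nonempty_of_finiteType` — **`∇X` exists for every `X` of finite type over a field `k`** (`X → Spec k` locally of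
  finite type and quasi-compact; then `X × X` is a Noetherian scheme).

HC_CM is proved only modulo the 7 printed citations until rung 0 closes; nothing here discharges a COR-CM binder.  Ours
(formalisation glue); axioms `propext`, `Classical.choice`, `Quot.sound`.

## References
* [Liu2021] Y. Liu, arXiv:2102.11518 = Camb. J. Math. 9 (2021), §2.1 Def. 2.1 (1) (l. 1171–1174).
* [GortzWedhorn2020] U. Görtz, T. Wedhorn, *Algebraic Geometry I*, 2nd ed. (2020), §(1.7) Def. 1.23, Lemma 1.25
  (noetherian topological spaces: finitely many irreducible components, p. 15), §(3.9) Remark 3.21 (p. 77).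
-/

noncomputable section

open CategoryTheory CategoryTheory.Limits AlgebraicGeometry MonoidalCategory CartesianMonoidalCategory TopologicalSpace
open Literature.AlgebraicGeometry.Motives

universe u

namespace Literature.NumberTheory.Automorphic.Liu2021.AppendixC

/-! ## §1 Clopen sets of a Noetherian space -/

section Clopen

variable {α : Type u} [TopologicalSpace α]

/-- **A clopen subset of a topological space is the union of the irreducible components it meets, i.e. of those it contains**
(an irreducible component is preconnected, so it lies inside a clopen set as soon as it meets it; every point lies in an
irreducible component). [cite: GortzWedhorn2020, §(1.7) Lemma 1.25 (3) and §(3.9) Remark 3.21] -/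
theorem IsClopen.eq_sUnion_irreducibleComponents {W : Set α} (hW : IsClopen W) :
    W = ⋃₀ {Z | Z ∈ irreducibleComponents α ∧ Z ⊆ W} := by
  refine Set.Subset.antisymm (fun x hx => ?_) (Set.sUnion_subset fun Z hZ => hZ.2)
  refine Set.mem_sUnion.2 ⟨irreducibleComponent x, ⟨irreducibleComponent_mem_irreducibleComponents x, ?_⟩,
    mem_irreducibleComponent⟩
  exact (IsIrreducible.isConnected isIrreducible_irreducibleComponent).isPreconnected.subset_isClopen hW
    ⟨x, mem_irreducibleComponent, hx⟩

/-- **A Noetherian topological space has only finitely many clopen subsets** (each is a union of a subfamily of the finitely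
many irreducible components). [cite: GortzWedhorn2020, §(1.7) Lemma 1.25 (3) and §(3.9) Remark 3.21] -/
theorem finite_setOf_isClopen [NoetherianSpace α] : {W : Set α | IsClopen W}.Finite := by
  have hfin : (irreducibleComponents α).Finite := NoetherianSpace.finite_irreducibleComponents
  refine (hfin.finite_subsets.image Set.sUnion).subset fun W hW => ?_
  exact ⟨{Z | Z ∈ irreducibleComponents α ∧ Z ⊆ W}, fun Z hZ => hZ.1,
    (IsClopen.eq_sUnion_irreducibleComponents hW).symm⟩

/-- **In a Noetherian topological space the intersection of ANY family of clopen sets is clopen** (the family is finite).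
[cite: GortzWedhorn2020, §(1.7) Lemma 1.25 (3) and §(3.9) Remark 3.21] -/
theorem isClopen_sInter_of_noetherianSpace [NoetherianSpace α] (S : Set (Set α)) (hS : ∀ W ∈ S, IsClopen W) :
    IsClopen (⋂₀ S) := by
  have hSfin : S.Finite := finite_setOf_isClopen.subset fun W hW => hS W hW
  exact ⟨isClosed_sInter fun W hW => (hS W hW).1, hSfin.isOpen_sInter fun W hW => (hS W hW).2⟩

end Clopen

/-! ## §2 Existence of `∇X` -/

section Existence

variable {k : Type u} [Field k] (X : SchemeOver k)

/-- **`∇X` exists when `X × X` is a Noetherian topological space** (Def. 2.1 (1): «the smallest open and closed subscheme of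
`X × X` containing the diagonal `ΔX`»): take `W₀ :=` the intersection of all clopen subsets of `X × X` containing the image
of `ΔX` — clopen by `isClopen_sInter_of_noetherianSpace`, containing `ΔX`, and contained in the image of every open and closed
subscheme `j : W ↪ X × X` through which `ΔX` factors (that image is one of the intersected sets); the tree's constructor
`Nabla.exists_of_isClopen` makes the open subscheme on `W₀` a `∇X`.  Ours. [cite: Liu2021, §2.1 Def. 2.1 (1) (l. 1171–1174)] -/
theorem Nabla.nonempty_of_noetherianSpace [NoetherianSpace ↥(X ⊗ X).left] : Nonempty (Nabla X) := by
  set D : Set ↥(X ⊗ X).left := Set.range ⇑(lift (𝟙 X) (𝟙 X)).left with hD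
  set S : Set (Set ↥(X ⊗ X).left) := {W | IsClopen W ∧ D ⊆ W} with hS
  set W₀ : Set ↥(X ⊗ X).left := ⋂₀ S with hW₀
  have hW₀c : IsClopen W₀ := isClopen_sInter_of_noetherianSpace S fun W hW => hW.1
  have hΔ : D ⊆ W₀ := Set.subset_sInter fun W hW => hW.2
  have hmin : ∀ (W : SchemeOver k) (j : W ⟶ X ⊗ X), IsOpenImmersion j.left → IsClosedImmersion j.left →
      (∃ δ : X ⟶ W, δ ≫ j = lift (𝟙 X) (𝟙 X)) → W₀ ⊆ Set.range ⇑j.left := by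
    intro W j hjo hjc hδ
    refine Set.sInter_subset_of_mem ⟨⟨j.left.isClosedEmbedding.isClosed_range, IsOpenImmersion.isOpen_range j.left⟩, ?_⟩
    obtain ⟨δ, hδj⟩ := hδ
    rintro _ ⟨x, rfl⟩
    refine ⟨δ.left x, ?_⟩
    rw [← Scheme.Hom.comp_apply, ← Over.comp_left, hδj]
  obtain ⟨N, -⟩ := exists_of_isClopen X W₀ hW₀c hΔ hmin
  exact ⟨N⟩

set_option backward.isDefEq.respectTransparency false in
/-- **`∇X` exists for every scheme `X` of finite type over a field `k`** (`X → Spec k` locally of finite type and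
quasi-compact): `X × X → Spec k` is then locally of finite type and quasi-compact, so `X × X` is a Noetherian scheme, in
particular a Noetherian topological space, and `Nabla.nonempty_of_noetherianSpace` applies.  Ours.
[cite: Liu2021, §2.1 Def. 2.1 (1) (l. 1171–1174)] -/
theorem Nabla.nonempty_of_finiteType [LocallyOfFiniteType X.hom] [QuasiCompact X.hom] : Nonempty (Nabla X) := by
  haveI : LocallyOfFiniteType (X ⊗ X).hom := by rw [Over.tensorObj_hom]; infer_instance
  haveI : QuasiCompact (X ⊗ X).hom := by rw [Over.tensorObj_hom]; infer_instance
  haveI : IsLocallyNoetherian (X ⊗ X).left := LocallyOfFiniteType.isLocallyNoetherian (X ⊗ X).hom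
  haveI : CompactSpace ↥(X ⊗ X).left := (quasiCompact_iff_compactSpace (X ⊗ X).hom).mp inferInstance
  haveI : IsNoetherian (X ⊗ X).left := { }
  exact Nabla.nonempty_of_noetherianSpace X

end Existence

end Literature.NumberTheory.Automorphic.Liu2021.AppendixC

end
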